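import Mathlib
import HarnessLib

/-!
# `HeteroclinicTriggerChain` — crux `TriggerChainFrontStep` (item stmt-NavierStokesRegularity-22785):
  the forced transfer arc, SEGMENT form (one-sided derivatives on `[0,T]`)

The lemmas of `…TriggerChainFrontStepForcedArc` (radius drift, no re-loading, capture, post-capture
trigger decay for `D′ = −2eu² + f₁`, `u′ = eDu + f₂` with `|f₁|, |f₂| ≤ φ`) were stated for functions
differentiable on all of `ℝ` (the lead's truncation ODE). The amplitudes of a lattice flow
(`TaoCascade.PseudoFlowOn`) are only `C¹` ON THE WINDOW, with derivatives WITHIN `[0,τ]`; this file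
re-proves the four lemmas under exactly that regularity — `HasDerivWithinAt … (Icc 0 T) t` for every
`t ∈ [0,T]` — so that they apply verbatim to the front block `D = S_{i₀,0} − S_{i₀,1}`, `u = S_{i₁,0}`
of an exact lattice flow once its remainders are identified (`…CarrierRow`, `…TriggerRow`). Same proofs
(fencing theorems of Mathlib with right derivatives), same constants.

HONEST FRAMING: elementary real analysis of a planar quadratic ODE with bounded forcing on a segment;
helper lemmas for the crux (no stub credit); nothing here is a statement about the Navier–Stokes
equations; no summit, rung or crux is proved by this file.
-/

noncomputable section

set_option linter.dupNamespace false

open Real Set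

namespace Summit.NavierStokesRegularity.NavierStokesRegularity.Theorems

/-- **Radius drift, segment form.** If on `[0,T]` (derivatives within the segment) `D′ = −2eu² + f₁`,
`u′ = eDu + f₂` with `|f₁|, |f₂| ≤ φ` and `|D|, |u| ≤ M`, then `|D(t)² + 2u(t)² − (D(0)² + 2u(0)²)| ≤ 6Mφ·t`
for `t ∈ [0,T]`. [folklore] -/
theorem heteroclinicTriggerChain_forcedArcOn_radius_drift {e φ M T : ℝ} {D u f₁ f₂ : ℝ → ℝ}
    (hD : ∀ t ∈ Icc 0 T, HasDerivWithinAt D (-(2 * e * u t ^ 2) + f₁ t) (Icc 0 T) t)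
    (hu : ∀ t ∈ Icc 0 T, HasDerivWithinAt u (e * D t * u t + f₂ t) (Icc 0 T) t)
    (hf₁ : ∀ t ∈ Icc 0 T, |f₁ t| ≤ φ) (hf₂ : ∀ t ∈ Icc 0 T, |f₂ t| ≤ φ)
    (hDM : ∀ t ∈ Icc 0 T, |D t| ≤ M) (huM : ∀ t ∈ Icc 0 T, |u t| ≤ M) :
    ∀ t ∈ Icc 0 T, |(D t ^ 2 + 2 * u t ^ 2) - (D 0 ^ 2 + 2 * u 0 ^ 2)| ≤ 6 * M * φ * t := by
  have hQ : ∀ t ∈ Icc 0 T, HasDerivWithinAt (fun s => D s ^ 2 + 2 * u s ^ 2)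
      (2 * D t * f₁ t + 4 * u t * f₂ t) (Icc 0 T) t := by
    intro t ht
    have h := ((hD t ht).pow 2).add (((hu t ht).pow 2).const_mul 2)
    refine h.congr_deriv ?_
    push_cast
    ring
  intro t ht
  have hbound : ∀ s ∈ Ico 0 T, ‖2 * D s * f₁ s + 4 * u s * f₂ s‖ ≤ 6 * M * φ := by
    intro s hs
    have hs' : s ∈ Icc 0 T := Ico_subset_Icc_self hs
    have h1 : |D s * f₁ s| ≤ M * φ := by
      rw [abs_mul]; exact mul_le_mul (hDM s hs') (hf₁ s hs') (abs_nonneg _) ((abs_nonneg _).trans (hDM s hs'))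
    have h2 : |u s * f₂ s| ≤ M * φ := by
      rw [abs_mul]; exact mul_le_mul (huM s hs') (hf₂ s hs') (abs_nonneg _) ((abs_nonneg _).trans (huM s hs'))
    rw [Real.norm_eq_abs]
    calc |2 * D s * f₁ s + 4 * u s * f₂ s| ≤ |2 * D s * f₁ s| + |4 * u s * f₂ s| := abs_add_le _ _
      _ = 2 * |D s * f₁ s| + 4 * |u s * f₂ s| := by
          rw [mul_assoc, mul_assoc, abs_mul, abs_mul]; norm_num
      _ ≤ 2 * (M * φ) + 4 * (M * φ) := by linarith
      _ = 6 * M * φ := by ring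
  have h := norm_image_sub_le_of_norm_deriv_le_segment' hQ hbound t ht
  simpa [Real.norm_eq_abs] using h

/-- **No re-loading after ignition, segment form**: with `e > 0` and `2u(0)² > 6MφT + φ/e`,
`D(t) ≤ D(0)` on `[0,T]`. [folklore] -/
theorem heteroclinicTriggerChain_forcedArcOn_no_reload {e φ M T : ℝ} {D u f₁ f₂ : ℝ → ℝ} (he : 0 < e)
    (hD : ∀ t ∈ Icc 0 T, HasDerivWithinAt D (-(2 * e * u t ^ 2) + f₁ t) (Icc 0 T) t)
    (hu : ∀ t ∈ Icc 0 T, HasDerivWithinAt u (e * D t * u t + f₂ t) (Icc 0 T) t)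
    (hf₁ : ∀ t ∈ Icc 0 T, |f₁ t| ≤ φ) (hf₂ : ∀ t ∈ Icc 0 T, |f₂ t| ≤ φ)
    (hDM : ∀ t ∈ Icc 0 T, |D t| ≤ M) (huM : ∀ t ∈ Icc 0 T, |u t| ≤ M)
    (hign : 6 * M * φ * T + φ / e < 2 * u 0 ^ 2) :
    ∀ t ∈ Icc 0 T, D t ≤ D 0 := by
  have hdrift := heteroclinicTriggerChain_forcedArcOn_radius_drift hD hu hf₁ hf₂ hDM huM
  have hDc : ContinuousOn D (Icc 0 T) := fun s hs => (hD s hs).continuousWithinAt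
  have hD' : ∀ s ∈ Ico 0 T, HasDerivWithinAt D (-(2 * e * u s ^ 2) + f₁ s) (Ici s) s := fun s hs =>
    (hD s (Ico_subset_Icc_self hs)).mono_of_mem_nhdsWithin (Icc_mem_nhdsGE_of_mem hs)
  intro t ht
  refine image_le_of_deriv_right_lt_deriv_boundary (f := D) (B := fun _ => D 0) (B' := fun _ => 0)
    (a := 0) (b := T) hDc hD' le_rfl (fun s => hasDerivAt_const s (D 0)) ?_ ht
  intro s hs hDs
  have hs' : s ∈ Icc 0 T := Ico_subset_Icc_self hs
  have hq := (abs_le.1 (hdrift s hs')).1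
  rw [hDs] at hq
  have hφ : 0 ≤ φ := (abs_nonneg _).trans (hf₁ s hs')
  have hM : 0 ≤ M := (abs_nonneg _).trans (hDM s hs')
  have hsT : 6 * M * φ * s ≤ 6 * M * φ * T := by
    have := hs.2.le; have h6 : 0 ≤ 6 * M * φ := by positivity
    exact mul_le_mul_of_nonneg_left this h6
  have hus : φ / e < 2 * u s ^ 2 := by linarith
  have hus' : φ < 2 * e * u s ^ 2 := by
    rw [div_lt_iff₀ he] at hus; linarith
  have hf := (abs_le.1 (hf₁ s hs')).2
  show -(2 * e * u s ^ 2) + f₁ s < 0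
  linarith

/-- **Capture, segment form**: under `2m + 6MφT ≤ 2u(0)²`, `L² + 2m + 6MφT ≤ D(0)² + 2u(0)²`,
`φ < 2em` and `(D(0)+L)/(2em − φ) ≤ T`, there is `t ∈ [0, max 0 ((D(0)+L)/(2em − φ))]` with
`D(t) ≤ −L`. [folklore] -/
theorem heteroclinicTriggerChain_forcedArcOn_capture {e φ M T : ℝ} {D u f₁ f₂ : ℝ → ℝ} (he : 0 < e)
    (hT : 0 ≤ T)
    (hD : ∀ t ∈ Icc 0 T, HasDerivWithinAt D (-(2 * e * u t ^ 2) + f₁ t) (Icc 0 T) t)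
    (hu : ∀ t ∈ Icc 0 T, HasDerivWithinAt u (e * D t * u t + f₂ t) (Icc 0 T) t)
    (hf₁ : ∀ t ∈ Icc 0 T, |f₁ t| ≤ φ) (hf₂ : ∀ t ∈ Icc 0 T, |f₂ t| ≤ φ)
    (hDM : ∀ t ∈ Icc 0 T, |D t| ≤ M) (huM : ∀ t ∈ Icc 0 T, |u t| ≤ M)
    {m L : ℝ} (hφm : φ < 2 * e * m) (hu0 : 2 * m + 6 * M * φ * T ≤ 2 * u 0 ^ 2)
    (hL : L ^ 2 + 2 * m + 6 * M * φ * T ≤ D 0 ^ 2 + 2 * u 0 ^ 2)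
    (hTT : (D 0 + L) / (2 * e * m - φ) ≤ T) :
    ∃ t ∈ Icc 0 (max 0 ((D 0 + L) / (2 * e * m - φ))), D t ≤ -L := by
  set T₁ : ℝ := max 0 ((D 0 + L) / (2 * e * m - φ))
  have hT₁0 : 0 ≤ T₁ := le_max_left _ _
  have hT₁T : T₁ ≤ T := max_le hT hTT
  have hγ : 0 < 2 * e * m - φ := by linarith
  have hφ : 0 ≤ φ := (abs_nonneg _).trans (hf₁ 0 ⟨le_rfl, hT⟩)
  have hM : 0 ≤ M := (abs_nonneg _).trans (hDM 0 ⟨le_rfl, hT⟩)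
  have hdrift := heteroclinicTriggerChain_forcedArcOn_radius_drift hD hu hf₁ hf₂ hDM huM
  have hm0 : φ / e < 2 * m := by rw [div_lt_iff₀ he]; linarith
  have hreload := heteroclinicTriggerChain_forcedArcOn_no_reload he hD hu hf₁ hf₂ hDM huM (by linarith)
  -- regularity of D on the sub-window [0, T₁]
  have hDc : ContinuousOn D (Icc 0 T₁) := fun s hs =>
    ((hD s ⟨hs.1, hs.2.trans hT₁T⟩).continuousWithinAt).mono (Icc_subset_Icc_right hT₁T)
  have hD' : ∀ s ∈ Ico 0 T₁, HasDerivWithinAt D (-(2 * e * u s ^ 2) + f₁ s) (Ici s) s := fun s hs =>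
    (hD s ⟨hs.1, hs.2.le.trans hT₁T⟩).mono_of_mem_nhdsWithin
      (Icc_mem_nhdsGE_of_mem ⟨hs.1, lt_of_lt_of_le hs.2 hT₁T⟩)
  by_contra hcon
  push Not at hcon
  have hderiv : ∀ s ∈ Ico 0 T₁, -(2 * e * u s ^ 2) + f₁ s ≤ -(2 * e * m - φ) := by
    intro s hs
    have hs₁ : s ∈ Icc 0 T₁ := Ico_subset_Icc_self hs
    have hs' : s ∈ Icc 0 T := ⟨hs.1, hs.2.le.trans hT₁T⟩
    have h1 : -L < D s := hcon s hs₁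
    have h2 : D s ≤ D 0 := hreload s hs'
    have hq := (abs_le.1 (hdrift s hs')).1
    have hsT : 6 * M * φ * s ≤ 6 * M * φ * T := by
      have h6 : 0 ≤ 6 * M * φ := by positivity
      exact mul_le_mul_of_nonneg_left hs'.2 h6
    have hsq : 2 * m ≤ 2 * u s ^ 2 := by
      rcases le_or_gt 0 (D s) with hpos | hneg
      · have : D s ^ 2 ≤ D 0 ^ 2 := by nlinarith
        nlinarith
      · have : D s ^ 2 ≤ L ^ 2 := by nlinarith
        nlinarith
    have hf := (abs_le.1 (hf₁ s hs')).2
    nlinarith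
  have hline := image_le_of_deriv_right_le_deriv_boundary (f := D) (a := 0) (b := T₁)
    (B := fun s => D 0 - (2 * e * m - φ) * s) (B' := fun _ => -(2 * e * m - φ))
    hDc hD' (by simp) (by fun_prop)
    (fun s _ => by
      have h := ((hasDerivAt_id s).const_mul (2 * e * m - φ)).const_sub (D 0)
      simpa using h.hasDerivWithinAt)
    hderiv (right_mem_Icc.2 hT₁0)
  have hlast : -L < D T₁ := hcon T₁ (right_mem_Icc.2 hT₁0)
  have hT₁ge : D 0 + L ≤ (2 * e * m - φ) * T₁ := by
    have h1 : (D 0 + L) / (2 * e * m - φ) ≤ T₁ := le_max_right _ _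
    rw [div_le_iff₀ hγ] at h1
    linarith
  have : D T₁ ≤ D 0 - (2 * e * m - φ) * T₁ := hline
  linarith

/-- **Post-capture trigger decay, segment form**: if on `[s,T]` (derivatives within the segment)
`u′ = eDu + f₂` with `e > 0`, `D ≤ −L < 0` and `|f₂| ≤ φ`, then
`|u(t)| ≤ |u(s)|·e^{−eL(t−s)} + φ/(eL)` for `t ∈ [s,T]`. [folklore] -/
theorem heteroclinicTriggerChain_forcedArcOn_trigger_decay {e φ L s T : ℝ} {D u f₂ : ℝ → ℝ}
    (he : 0 < e) (hL : 0 < L)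
    (hu : ∀ t ∈ Icc s T, HasDerivWithinAt u (e * D t * u t + f₂ t) (Icc s T) t)
    (hf₂ : ∀ t ∈ Icc s T, |f₂ t| ≤ φ) (hDL : ∀ t ∈ Icc s T, D t ≤ -L) :
    ∀ t ∈ Icc s T, |u t| ≤ |u s| * Real.exp (-(e * L * (t - s))) + φ / (e * L) := by
  intro t ht
  rcases lt_or_ge T s with hTs | hsT
  · exact absurd (ht.1.trans ht.2) (not_le.2 hTs)
  have hφ : 0 ≤ φ := (abs_nonneg _).trans (hf₂ s ⟨le_rfl, hsT⟩)
  have heL : 0 < e * L := mul_pos he hL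
  set E : ℝ → ℝ := fun r => Real.exp (e * L * (r - s)) with hE
  have hEpos : ∀ r, 0 < E r := fun r => Real.exp_pos _
  have hEd : ∀ r, HasDerivAt E (e * L * E r) r := by
    intro r
    have h := (((hasDerivAt_id r).sub_const s).const_mul (e * L)).exp
    refine h.congr_deriv ?_
    simp [hE]; ring
  have hW : ∀ r ∈ Icc s T, HasDerivWithinAt (fun r => (u r * E r) ^ 2)
      (2 * E r ^ 2 * (e * (D r + L) * u r ^ 2 + u r * f₂ r)) (Icc s T) r := by
    intro r hr
    have h1 : HasDerivWithinAt (fun r => u r * E r)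
        ((e * D r * u r + f₂ r) * E r + u r * (e * L * E r)) (Icc s T) r :=
      (hu r hr).mul (hEd r).hasDerivWithinAt
    have h := h1.pow 2
    refine h.congr_deriv ?_
    push_cast
    ring
  have hWc : ContinuousOn (fun r => (u r * E r) ^ 2) (Icc s T) := fun r hr => (hW r hr).continuousWithinAt
  have hW' : ∀ r ∈ Ico s T, HasDerivWithinAt (fun r => (u r * E r) ^ 2)
      (2 * E r ^ 2 * (e * (D r + L) * u r ^ 2 + u r * f₂ r)) (Ici r) r := fun r hr =>
    (hW r (Ico_subset_Icc_self hr)).mono_of_mem_nhdsWithin (Icc_mem_nhdsGE_of_mem hr)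
  have hmain : ∀ ε : ℝ, 0 < ε →
      (u t * E t) ^ 2 ≤ (|u s| + ε + (φ + ε) * ((E t - 1) / (e * L))) ^ 2 := by
    intro ε hε
    have hBd : ∀ r, HasDerivAt (fun r => |u s| + ε + (φ + ε) * ((E r - 1) / (e * L)))
        ((φ + ε) * E r) r := by
      intro r
      have h := (((hEd r).sub_const 1).div_const (e * L)).const_mul (φ + ε) |>.const_add (|u s| + ε)
      refine h.congr_deriv ?_
      field_simp
    have hBpos : ∀ r ∈ Icc s T, 0 < |u s| + ε + (φ + ε) * ((E r - 1) / (e * L)) := by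
      intro r hr
      have h1 : 1 ≤ E r := by
        simp only [hE]; exact Real.one_le_exp (mul_nonneg heL.le (by linarith [hr.1]))
      have : 0 ≤ (φ + ε) * ((E r - 1) / (e * L)) := by
        apply mul_nonneg (by linarith); exact div_nonneg (by linarith) heL.le
      have := abs_nonneg (u s)
      linarith
    have hB2 : ∀ r, HasDerivAt (fun r => (|u s| + ε + (φ + ε) * ((E r - 1) / (e * L))) ^ 2)
        (2 * (|u s| + ε + (φ + ε) * ((E r - 1) / (e * L))) * ((φ + ε) * E r)) r := by
      intro r
      have h := (hBd r).pow 2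
      refine h.congr_deriv ?_
      push_cast; ring
    refine image_le_of_deriv_right_lt_deriv_boundary (a := s) (b := T)
      (f := fun r => (u r * E r) ^ 2) hWc hW' ?_ hB2 ?_ ht
    · have hEs : E s = 1 := by simp [hE]
      simp only [hEs, mul_one, sub_self, zero_div, mul_zero, add_zero]
      have h0 : |u s| ≤ |u s| + ε := by linarith
      calc u s ^ 2 = |u s| ^ 2 := (sq_abs _).symm
        _ ≤ (|u s| + ε) ^ 2 := by
            exact pow_le_pow_left₀ (abs_nonneg _) h0 2
    · intro r hr hcontact
      have hr' : r ∈ Icc s T := Ico_subset_Icc_self hr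
      set B : ℝ := |u s| + ε + (φ + ε) * ((E r - 1) / (e * L)) with hB
      have hBp : 0 < B := hBpos r hr'
      have habs : |u r| * E r = B := by
        have h1 : (|u r| * E r) ^ 2 = B ^ 2 := by
          rw [mul_pow, sq_abs, ← mul_pow]; exact hcontact
        have h2 : 0 ≤ |u r| * E r := mul_nonneg (abs_nonneg _) (hEpos r).le
        nlinarith [sq_nonneg (|u r| * E r - B), sq_nonneg (|u r| * E r + B)]
      have hDr : D r + L ≤ 0 := by linarith [hDL r hr']
      have h1 : e * (D r + L) * u r ^ 2 ≤ 0 :=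
        mul_nonpos_of_nonpos_of_nonneg (mul_nonpos_of_nonneg_of_nonpos he.le hDr) (sq_nonneg _)
      have h2 : u r * f₂ r ≤ |u r| * φ := by
        calc u r * f₂ r ≤ |u r * f₂ r| := le_abs_self _
          _ = |u r| * |f₂ r| := abs_mul _ _
          _ ≤ |u r| * φ := mul_le_mul_of_nonneg_left (hf₂ r hr') (abs_nonneg _)
      have hE2 : 0 < E r ^ 2 := pow_pos (hEpos r) 2
      calc 2 * E r ^ 2 * (e * (D r + L) * u r ^ 2 + u r * f₂ r)
          ≤ 2 * E r ^ 2 * (|u r| * φ) := by nlinarith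
        _ = 2 * B * (φ * E r) := by rw [← habs]; ring
        _ < 2 * B * ((φ + ε) * E r) := by
            have : φ * E r < (φ + ε) * E r := by nlinarith [hEpos r]
            nlinarith
  have hE1 : 1 ≤ E t := by
    simp only [hE]; exact Real.one_le_exp (mul_nonneg heL.le (by linarith [ht.1]))
  have hc : 0 ≤ (E t - 1) / (e * L) := div_nonneg (by linarith) heL.le
  have hroot : ∀ ε : ℝ, 0 < ε → |u t| * E t ≤ |u s| + ε + (φ + ε) * ((E t - 1) / (e * L)) := by
    intro ε hε
    have hBp : 0 ≤ |u s| + ε + (φ + ε) * ((E t - 1) / (e * L)) := by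
      have : 0 ≤ (φ + ε) * ((E t - 1) / (e * L)) := mul_nonneg (by linarith) hc
      have := abs_nonneg (u s); linarith
    have h := sq_le_sq.1 (hmain ε hε)
    rwa [abs_mul, abs_of_pos (hEpos t), abs_of_nonneg hBp] at h
  have hlim : |u t| * E t ≤ |u s| + φ * ((E t - 1) / (e * L)) := by
    refine le_of_forall_pos_le_add fun ε' hε' => ?_
    have hpos : 0 < 1 + (E t - 1) / (e * L) := by linarith
    have h := hroot (ε' / (1 + (E t - 1) / (e * L))) (div_pos hε' hpos)
    have key : ε' / (1 + (E t - 1) / (e * L)) * (1 + (E t - 1) / (e * L)) = ε' :=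
      div_mul_cancel₀ _ hpos.ne'
    calc |u t| * E t ≤ |u s| + ε' / (1 + (E t - 1) / (e * L)) +
          (φ + ε' / (1 + (E t - 1) / (e * L))) * ((E t - 1) / (e * L)) := h
      _ = |u s| + φ * ((E t - 1) / (e * L)) +
          ε' / (1 + (E t - 1) / (e * L)) * (1 + (E t - 1) / (e * L)) := by ring
      _ = |u s| + φ * ((E t - 1) / (e * L)) + ε' := by rw [key]
  have hsplit : φ * ((E t - 1) / (e * L)) = φ / (e * L) * E t - φ / (e * L) := by
    field_simp
  have h2 : |u t| * E t ≤ |u s| + φ / (e * L) * E t := by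
    have : 0 ≤ φ / (e * L) := div_nonneg hφ heL.le
    linarith
  have hEt := hEpos t
  have hinv : Real.exp (-(e * L * (t - s))) = (E t)⁻¹ := by rw [Real.exp_neg]
  rw [hinv]
  calc |u t| = |u t| * E t * (E t)⁻¹ := by field_simp
    _ ≤ (|u s| + φ / (e * L) * E t) * (E t)⁻¹ := mul_le_mul_of_nonneg_right h2 (inv_nonneg.2 hEt.le)
    _ = |u s| * (E t)⁻¹ + φ / (e * L) := by field_simp

end Summit.NavierStokesRegularity.NavierStokesRegularity.Theorems

end
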